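import Literature.Probability.Percolation.LonePortSumGeneral
import HarnessLib

/-!
# Off-cluster Harris given set-avoidance: two increasing statistics read off the configuration outside
# the cluster of `s` are positively correlated given `{s ↮ X}` (Sahi programme, prover prim-sahi-p2 gen 33)

Support file (`--supports stmt-CriticalPhenomena-4575`).  No definitions, no named facts, no sorries; standard axioms.
Memo `run/shared/lean/prim/prim-sahi/FROM-prim-sahi-p2-gen33-TWO-LEVEL-ORACLE.md` §2, `prim-sahi-p2/PROOF-E3.md` §43.

The 'two-level' row family CA of the gen-33 semantic oracle for the tangent inequality R23 consists of
van den Berg–Häggström–Kahn's conditional positive association of the cluster `C_s` given `D_X = {s ↮ X}`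
(tree: `BHK2006_clusterConditionalPositiveAssociation_holds`, rows CA3), of the cluster / off-cluster
correlation of `Literature/…/LonePortSumGeneral.lean` (`setSep_offCluster_negCorrelation`, rows CA2), and of
the inequality proved here (rows CA1): for `s ∉ X` and two statistics `G₁, G₂ ≥ 0` of the configuration that are
INCREASING and LOCAL off the cluster of `s` (on `D_X`, `G_i(ω ∖ W̄(C_s ω)) = G_i(ω)`, `W̄` = the pairs meeting
`{s} ∪ V(C_s)`),

  `(∫_{D_X} G₁ dμ) · (∫_{D_X} G₂ dμ) ≤ μ(D_X) · ∫_{D_X} G₁ G₂ dμ`      (`setSep_offCluster_harris`).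

Proof (BHK pp. 7–8 run with two statistics): conditionally on `C_s = W` the configuration off `W̄` is fresh
(`BHK2006.sum_cond_cluster_sdiff`), so `∫_{D_X} G_i = ∫_{D_X} ψ_i(C_s)` and `∫_{D_X} G₁G₂ = ∫_{D_X} ψ₁₂(C_s)` with
`ψ_i(W) = E[G_i(η ∖ W̄)]`, `ψ₁₂(W) = E[G₁(η ∖ W̄) G₂(η ∖ W̄)]`; Harris for the fresh product measure gives
`ψ₁ψ₂ ≤ ψ₁₂` pointwise, both `ψ_i` are DEcreasing in `W`, and BHK's Theorem 1.3 given `{s ↮ X}` for the two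
decreasing functions `ψ₁, ψ₂` of `C_s` finishes.  Event form (`offCluster_openConn_posCorr`): for `z₁, z₂ ∈ X` and
any `a, b`,
  `μ(D_X ∩ {z₁↔a}) · μ(D_X ∩ {z₂↔b}) ≤ μ(D_X) · μ(D_X ∩ {z₁↔a} ∩ {z₂↔b})`
— given that the cluster of `s` avoids `X`, connections FROM vertices of `X` (which necessarily run off `C_s`)
are positively correlated.  This is strictly stronger than the corresponding instance of BHK's Theorem 1.5
(which carries the factor `μ{s ↮ z}` instead of `μ(D_X)`), and it is what the oracle's CA1 rows assert.
-/

noncomputable section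

open MeasureTheory Set
open Literature.Probability.LatticeModels Literature.Probability.Percolation
open Literature.Probability.Percolation.LonePortSum Literature.Probability.Percolation.LonePortSumGeneral
open Literature.Probability.Percolation.BHK2006 Literature.Probability.Percolation.DecisionTree

namespace Summit.CriticalPhenomena.PercolationContinuityZ3.Theorems

namespace OffClusterHarris

open scoped Classical

variable {V : Type*}

/-- **Off-cluster Harris given `{s ↮ X}`.**  For `s ∉ X` and statistics `G₁, G₂ ≥ 0` of the configuration that
are monotone and local off the cluster of `s` on `D_X = {s ↮ X}`:
`(∫_{D_X} G₁)(∫_{D_X} G₂) ≤ μ(D_X) · ∫_{D_X} G₁ G₂`. [this work] -/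
theorem setSep_offCluster_harris [Fintype V] (w : Sym2 V → unitInterval) (s : V) (X : Set V)
    (hs : s ∉ X) (G₁ G₂ : BondConfig V → ℝ) (hG₁ : Monotone G₁) (hG₂ : Monotone G₂)
    (h₁0 : ∀ ω, 0 ≤ G₁ ω) (h₂0 : ∀ ω, 0 ≤ G₂ ω)
    (hloc₁ : ∀ ω : BondConfig V, (∀ x ∈ X, ¬ (openGraph ω).Reachable s x) →
      G₁ (ω \ {e | ∃ v ∈ e, v = s ∨ ∃ e' ∈ openEdgeCluster ω s, v ∈ e'}) = G₁ ω)
    (hloc₂ : ∀ ω : BondConfig V, (∀ x ∈ X, ¬ (openGraph ω).Reachable s x) →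
      G₂ (ω \ {e | ∃ v ∈ e, v = s ∨ ∃ e' ∈ openEdgeCluster ω s, v ∈ e'}) = G₂ ω) :
    (∫ ω in {ω : BondConfig V | ∀ x ∈ X, ¬ (openGraph ω).Reachable s x}, G₁ ω ∂(prodBernoulli w)) *
      (∫ ω in {ω : BondConfig V | ∀ x ∈ X, ¬ (openGraph ω).Reachable s x}, G₂ ω ∂(prodBernoulli w)) ≤
    (prodBernoulli w).real {ω : BondConfig V | ∀ x ∈ X, ¬ (openGraph ω).Reachable s x} *
      ∫ ω in {ω : BondConfig V | ∀ x ∈ X, ¬ (openGraph ω).Reachable s x}, G₁ ω * G₂ ω ∂(prodBernoulli w) := by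
  classical
  set DX : Set (BondConfig V) := {ω | ∀ x ∈ X, ¬ (openGraph ω).Reachable s x} with hDX
  set w' : Sym2 V → ℝ := fun e => (w e : ℝ) with hw'
  have hw0 : ∀ e, 0 ≤ w' e := fun e => (w e).2.1
  have hw1 : ∀ e, w' e ≤ 1 := fun e => (w e).2.2
  have hm : ∑ ω, weight w' ω = 1 := by
    have h1 := integral_prodBernoulli_eq_sum w fun _ => (1 : ℝ)
    simp only [integral_const, probReal_univ, smul_eq_mul, mul_one] at h1
    exact h1.symm
  -- `1_{D_X} = NX(C_s)`
  set NX : Set (Sym2 V) → ℝ := fun C => if ∀ x ∈ X, ¬ (x = s ∨ ∃ e ∈ C, x ∈ e) then 1 else 0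
    with hNX
  have hind : ∀ ω : BondConfig V, ind DX ω = NX (openEdgeCluster ω s) := by
    intro ω
    by_cases hω : ω ∈ DX
    · have hω' : ∀ x ∈ X, ¬ (openGraph ω).Reachable s x := hω
      have h1 : ∀ x ∈ X, ¬ (x = s ∨ ∃ e ∈ openEdgeCluster ω s, x ∈ e) := fun x hx h =>
        hω' x hx ((reachable_iff_exists_mem_openEdgeCluster ω s x).2 h)
      rw [ind_of_mem hω, hNX]
      simp only [if_pos h1]
    · have hω' : ∃ x ∈ X, (openGraph ω).Reachable s x := by
        by_contra hcon
        exact hω fun x hx hr => hcon ⟨x, hx, hr⟩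
      obtain ⟨x, hx, hr⟩ := hω'
      have h1 : ¬ ∀ x ∈ X, ¬ (x = s ∨ ∃ e ∈ openEdgeCluster ω s, x ∈ e) := fun h =>
        h x hx ((reachable_iff_exists_mem_openEdgeCluster ω s x).1 hr)
      rw [ind_of_not_mem hω, hNX]
      simp only [if_neg h1]
  -- pointwise identities on `D_X`
  have hptw : ∀ (G : BondConfig V → ℝ),
      (∀ ω : BondConfig V, (∀ x ∈ X, ¬ (openGraph ω).Reachable s x) →
        G (ω \ {e | ∃ v ∈ e, v = s ∨ ∃ e' ∈ openEdgeCluster ω s, v ∈ e'}) = G ω) →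
      ∀ ω : BondConfig V, G ω * ind DX ω =
        NX (openEdgeCluster ω s) * G (ω \ {e | ∃ v ∈ e, v = s ∨ ∃ e' ∈ openEdgeCluster ω s, v ∈ e'}) := by
    intro G hloc ω
    rw [hind ω]
    by_cases hω : ω ∈ DX
    · rw [hloc ω hω, mul_comm]
    · have h0 : NX (openEdgeCluster ω s) = 0 := by rw [← hind ω, ind_of_not_mem hω]
      rw [h0, zero_mul, mul_zero]
  have hloc₁₂ : ∀ ω : BondConfig V, (∀ x ∈ X, ¬ (openGraph ω).Reachable s x) →
      (fun ω => G₁ ω * G₂ ω) (ω \ {e | ∃ v ∈ e, v = s ∨ ∃ e' ∈ openEdgeCluster ω s, v ∈ e'}) =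
        (fun ω => G₁ ω * G₂ ω) ω := by
    intro ω hω
    simp only [hloc₁ ω hω, hloc₂ ω hω]
  -- the conditional means `ψ₁, ψ₂, ψ₁₂`
  set ψ₁ : Set (Sym2 V) → ℝ := fun W => ∑ η, weight w' η *
      G₁ (η \ {e | ∃ v ∈ e, v = s ∨ ∃ e' ∈ W, v ∈ e'}) with hψ₁
  set ψ₂ : Set (Sym2 V) → ℝ := fun W => ∑ η, weight w' η *
      G₂ (η \ {e | ∃ v ∈ e, v = s ∨ ∃ e' ∈ W, v ∈ e'}) with hψ₂
  set ψ₁₂ : Set (Sym2 V) → ℝ := fun W => ∑ η, weight w' η *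
      (G₁ (η \ {e | ∃ v ∈ e, v = s ∨ ∃ e' ∈ W, v ∈ e'}) *
        G₂ (η \ {e | ∃ v ∈ e, v = s ∨ ∃ e' ∈ W, v ∈ e'})) with hψ₁₂
  have hψ₁anti : Antitone ψ₁ := by
    intro W W' hWW'
    refine Finset.sum_le_sum fun η _ => mul_le_mul_of_nonneg_left ?_ (weight_nonneg hw0 hw1 η)
    exact hG₁ (Set.sdiff_subset_sdiff_right (bar_mono s hWW'))
  have hψ₂anti : Antitone ψ₂ := by
    intro W W' hWW'
    refine Finset.sum_le_sum fun η _ => mul_le_mul_of_nonneg_left ?_ (weight_nonneg hw0 hw1 η)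
    exact hG₂ (Set.sdiff_subset_sdiff_right (bar_mono s hWW'))
  -- Harris for the fresh product measure: `ψ₁ ψ₂ ≤ ψ₁₂` pointwise
  have hharris : ∀ W, ψ₁ W * ψ₂ W ≤ ψ₁₂ W := by
    intro W
    have h := harris hw0 hw1
      (f := fun η => G₁ (η \ {e | ∃ v ∈ e, v = s ∨ ∃ e' ∈ W, v ∈ e'}))
      (g := fun η => G₂ (η \ {e | ∃ v ∈ e, v = s ∨ ∃ e' ∈ W, v ∈ e'}))
      (fun η => h₁0 _) (fun η => h₂0 _)
      (fun a b hab => hG₁ (Set.sdiff_subset_sdiff_left hab))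
      (fun a b hab => hG₂ (Set.sdiff_subset_sdiff_left hab))
    rw [hm, one_mul] at h
    exact h
  -- display (10) for the three statistics
  have hsum : ∀ (G : BondConfig V → ℝ),
      (∀ ω : BondConfig V, (∀ x ∈ X, ¬ (openGraph ω).Reachable s x) →
        G (ω \ {e | ∃ v ∈ e, v = s ∨ ∃ e' ∈ openEdgeCluster ω s, v ∈ e'}) = G ω) →
      ∫ ω in DX, G ω ∂(prodBernoulli w) =
        ∫ ω in DX, (fun W => ∑ η, weight w' η * G (η \ {e | ∃ v ∈ e, v = s ∨ ∃ e' ∈ W, v ∈ e'}))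
          (openEdgeCluster ω s) ∂(prodBernoulli w) := by
    intro G hloc
    have e2 := sum_cond_cluster_sdiff w' hm s (fun C ξ => NX C * G ξ)
    rw [setIntegral_eq_sum w DX, setIntegral_eq_sum w DX]
    have lhs : ∑ ω, weight w' ω * (G ω * ind DX ω) =
        ∑ ω, weight w' ω * ((fun C ξ => NX C * G ξ) (openEdgeCluster ω s)
          (ω \ {e | ∃ v ∈ e, v = s ∨ ∃ e' ∈ openEdgeCluster ω s, v ∈ e'})) :=
      Finset.sum_congr rfl fun ω _ => by simp only; rw [hptw G hloc ω]
    rw [lhs, e2]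
    refine Finset.sum_congr rfl fun ω _ => ?_
    rw [hind ω]
    simp only [Finset.mul_sum, Finset.sum_mul]
    refine Finset.sum_congr rfl fun η _ => ?_
    ring
  have i1 : ∫ ω in DX, G₁ ω ∂(prodBernoulli w) = ∫ ω in DX, ψ₁ (openEdgeCluster ω s) ∂(prodBernoulli w) :=
    hsum G₁ hloc₁
  have i2 : ∫ ω in DX, G₂ ω ∂(prodBernoulli w) = ∫ ω in DX, ψ₂ (openEdgeCluster ω s) ∂(prodBernoulli w) :=
    hsum G₂ hloc₂
  have i12 : ∫ ω in DX, G₁ ω * G₂ ω ∂(prodBernoulli w) =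
      ∫ ω in DX, ψ₁₂ (openEdgeCluster ω s) ∂(prodBernoulli w) :=
    hsum (fun ω => G₁ ω * G₂ ω) hloc₁₂
  -- Theorem 1.3 for the two DEcreasing functions `ψ₁, ψ₂` of `C_s` given `{s ↮ X}`
  have h13 := BHK2006_clusterConditionalPositiveAssociation_holds V w s X (fun C => -ψ₁ C) (fun C => -ψ₂ C)
    (fun _ _ hab => neg_le_neg (hψ₁anti hab)) (fun _ _ hab => neg_le_neg (hψ₂anti hab)) hs
  simp only [integral_neg, neg_mul_neg] at h13
  -- `∫_{D_X} ψ₁ψ₂(C_s) ≤ ∫_{D_X} ψ₁₂(C_s)` (Harris pointwise)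
  have hmono : ∫ ω in DX, ψ₁ (openEdgeCluster ω s) * ψ₂ (openEdgeCluster ω s) ∂(prodBernoulli w) ≤
      ∫ ω in DX, ψ₁₂ (openEdgeCluster ω s) ∂(prodBernoulli w) := by
    rw [setIntegral_eq_sum w DX, setIntegral_eq_sum w DX]
    refine Finset.sum_le_sum fun ω _ => mul_le_mul_of_nonneg_left ?_ (weight_nonneg hw0 hw1 ω)
    exact mul_le_mul_of_nonneg_right (hharris _) (ind_nonneg DX ω)
  have hD0 : 0 ≤ (prodBernoulli w).real DX := measureReal_nonneg
  rw [i1, i2, i12]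
  exact h13.trans (mul_le_mul_of_nonneg_left hmono hD0)

/-- The indicator of an open connection `{z ↔ a}` as a real statistic of the configuration. [folklore] -/
theorem ind_openConn_eq (z a : V) (ω : BondConfig V) :
    ind (openConn z a : Set (BondConfig V)) ω = if (openGraph ω).Reachable z a then 1 else 0 := by
  by_cases h : (openGraph ω).Reachable z a
  · rw [ind_of_mem (show ω ∈ (openConn z a : Set (BondConfig V)) from h), if_pos h]
  · rw [ind_of_not_mem (show ω ∉ (openConn z a : Set (BondConfig V)) from h), if_neg h]

/-- **Connections from vertices of `X` are positively correlated given `{s ↮ X}`** (event form of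
`setSep_offCluster_harris`; the gen-33 oracle rows CA1): for `s ∉ X`, `z₁, z₂ ∈ X`, any `a, b`, with
`D_X = {s ↮ X}`:  `μ(D_X ∩ {z₁↔a}) · μ(D_X ∩ {z₂↔b}) ≤ μ(D_X) · μ(D_X ∩ ({z₁↔a} ∩ {z₂↔b}))`.  [this work] -/
theorem offCluster_openConn_posCorr [Fintype V] (w : Sym2 V → unitInterval) (s : V) (X : Set V) (hs : s ∉ X)
    {z₁ z₂ : V} (hz₁ : z₁ ∈ X) (hz₂ : z₂ ∈ X) (a b : V) :
    (prodBernoulli w).real ({ω : BondConfig V | ∀ x ∈ X, ¬ (openGraph ω).Reachable s x} ∩ openConn z₁ a) *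
      (prodBernoulli w).real ({ω : BondConfig V | ∀ x ∈ X, ¬ (openGraph ω).Reachable s x} ∩ openConn z₂ b) ≤
    (prodBernoulli w).real {ω : BondConfig V | ∀ x ∈ X, ¬ (openGraph ω).Reachable s x} *
      (prodBernoulli w).real ({ω : BondConfig V | ∀ x ∈ X, ¬ (openGraph ω).Reachable s x} ∩
        (openConn z₁ a ∩ openConn z₂ b)) := by
  classical
  set DX : Set (BondConfig V) := {ω | ∀ x ∈ X, ¬ (openGraph ω).Reachable s x} with hDX
  -- the two statistics
  set G₁ : BondConfig V → ℝ := ind (openConn z₁ a : Set (BondConfig V)) with hG₁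
  set G₂ : BondConfig V → ℝ := ind (openConn z₂ b : Set (BondConfig V)) with hG₂
  have hmono : ∀ (z c : V), Monotone (ind (openConn z c : Set (BondConfig V))) := by
    intro z c ω ω' hab
    by_cases h : ω ∈ (openConn z c : Set (BondConfig V))
    · rw [ind_of_mem h, ind_of_mem (isUpperSet_openConn z c hab h)]
    · rw [ind_of_not_mem h]; exact ind_nonneg _ _
  have hloc : ∀ (z c : V), z ∈ X → ∀ ω : BondConfig V, (∀ x ∈ X, ¬ (openGraph ω).Reachable s x) →
      ind (openConn z c : Set (BondConfig V)) (ω \ {e | ∃ v ∈ e, v = s ∨ ∃ e' ∈ openEdgeCluster ω s, v ∈ e'}) =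
        ind (openConn z c : Set (BondConfig V)) ω := by
    intro z c hz ω hω
    rw [ind_openConn_eq, ind_openConn_eq, reachable_sdiff_bar_iff (hω z hz) c]
  have key := setSep_offCluster_harris w s X hs G₁ G₂ (hmono z₁ a) (hmono z₂ b)
    (fun ω => ind_nonneg _ ω) (fun ω => ind_nonneg _ ω) (hloc z₁ a hz₁) (hloc z₂ b hz₂)
  -- rewrite the integrals as measures
  have r1 : ∫ ω in DX, G₁ ω ∂(prodBernoulli w) = (prodBernoulli w).real (DX ∩ openConn z₁ a) := by
    rw [setIntegral_eq_sum w DX, measureReal_eq_sum w]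
    refine Finset.sum_congr rfl fun ω _ => ?_
    rw [hG₁, ← ind_inter, Set.inter_comm]
  have r2 : ∫ ω in DX, G₂ ω ∂(prodBernoulli w) = (prodBernoulli w).real (DX ∩ openConn z₂ b) := by
    rw [setIntegral_eq_sum w DX, measureReal_eq_sum w]
    refine Finset.sum_congr rfl fun ω _ => ?_
    rw [hG₂, ← ind_inter, Set.inter_comm]
  have r12 : ∫ ω in DX, G₁ ω * G₂ ω ∂(prodBernoulli w) =
      (prodBernoulli w).real (DX ∩ (openConn z₁ a ∩ openConn z₂ b)) := by
    rw [setIntegral_eq_sum w DX, measureReal_eq_sum w]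
    refine Finset.sum_congr rfl fun ω _ => ?_
    rw [hG₁, hG₂, ← ind_inter, ← ind_inter, Set.inter_comm]
  rw [r1, r2, r12] at key
  exact key

end OffClusterHarris

end Summit.CriticalPhenomena.PercolationContinuityZ3.Theorems

end
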